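import Literature.MathematicalPhysics.QuantumFieldTheory.Balaban1983to89.B6Ineq243AdjTwoLevelBox
import Literature.MathematicalPhysics.QuantumFieldTheory.Balaban1983to89.B4Thm19ZeroBoxHolderDualMeshOne

/-!
# `Balaban1983to89.B6Ineq243AdjTwoLevelBoxL0` — the LEVEL-0 TWIN of `B6Ineq243AdjTwoLevelBox`: [B6] (2.43) for the third operator `G′(□)∂^{L^{−j}*}_μ` of [3] Lemma 2.2 (entry 3′ of (2.67)) for the genuine two-level cube propagator
# `G′(□)` at EVERY mesh `L^{−j}`, `j ≥ 0` (the binder «1 ≤ k» of the original removed), so that the `(0, 1)` two-level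
# cubes of a nested family WITH LEVEL 0 (`Λ₀ = T ∖ Ω₁ ≠ ∅`) are covered

statement-level skeleton of published theorems with citation tags; proofs where landed; nothing here is a claim about the Yang–Mills mass gap

Source: T. Bałaban, *Propagators and renormalization transformations for lattice gauge theories. II*, Commun. Math.
Phys. **96** (1984) 223–250 [`Balaban1984PropagatorsII`, "B6"], p. 225 [PDF 3] (2.14) (the index `j` running from `0`),
p. 229 [PDF 7] «Taking these covers for all j from 0 to k we get a family 𝔇 of cubes □», p. 230 [PDF 8] (2.40)–(2.44),
p. 234 [PDF 12] Proposition 2.2 (2.67); T. Bałaban, *Regularity and decay of lattice Green's functions*, Commun. Math.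
Phys. **89** (1983) 571–597 [`Balaban1983RegularityDecay`, "[3]" of B6] — Theorem (1.9)/(1.10), Lemma 2.2 (2.17),
Lemma 2.4 (2.35)–(2.36) «for arbitrary non-negative integer j», as PROVED at `A = 0` for boxes at every mesh `k ≥ 0`
in `B4Thm110ZeroBoxMeshOne`, `B4Thm19ZeroBoxHolderMeshOne`, `B4Thm19ZeroBoxHolderDualMeshOne`.

## WHY THIS FILE (row G-F3′-L0 of the lit-balaban cell, packet S-B of `lit-balaban-r03/G-F3L0-PLAN.md` §5)

`B6Ineq243AdjTwoLevelBox` states its estimate(s) (`ineq243_twoLevel_dstar_roww` :231, `ineq243_twoLevel_dstar_value` :272) with the binder `∀ k, 1 ≤ k →` inherited from the [3] box theorems as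
typed for «k … an arbitrary positive integer» (B4 p. 572).  In a nested family WITH LEVEL 0 (plan §1: level 0 = the
index `j = 0` of (2.14)/(2.19)–(2.20) with a finite lattice-scale weight, `Q′₀ = Q₀ = id`) the cubes meeting `Λ₀` and
`Λ₁` carry the two-level operator at mesh `L^{−0} = 1`: the `k = 0` member of the SAME matrix family
`twoLevelOp`/`gTwoLevel` (`n = 1`), whose inversion and deterministic assembly lemmas are mesh-free (`hn : 1 ≤ n`).
Only the [3] inputs carried `1 ≤ k`; their all-scales forms now exist.  PORT DISCIPLINE (plan §4): SAME declaration
names and binder order in the namespace `…B6Ineq243AdjTwoLevelBoxL0`, the binder `1 ≤ k →` deleted, proofs = the original assembly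
VERBATIM over the `_all` inputs, every mesh-free declaration of the original used BY NAME (nothing restated or edited).

## HONEST SCOPE

Exactly that of `B6Ineq243AdjTwoLevelBox` (its header, HONEST SCOPE and DICTIONARY apply verbatim), plus: the `k = 0` member is the
unit-mesh two-level cube (level `j = 0` = points, level `1` = `L`-blocks, weights `a_j`, `a_{j+1} = aNext ℓ a_j a`);
whether a given nested family uses this member with these weights is the consumer's reading of (2.14) at `j = 0` (plan
§1, OWNER-confirmed), not a claim of this file; constants are `min`/`max`-merges of the `k ≥ 1` and `k = 0` constants.

Value = kernel certificate (level-0-capable cube inputs of [B6] Prop. 2.2 (2.67)), NOT summit progress: the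
Yang–Mills / `Summit.QuantumFields` statements are untouched; no Literature fact is minted.
-/

namespace Literature.MathematicalPhysics.QuantumFieldTheory.Balaban1983to89.B6Ineq243AdjTwoLevelBoxL0

open Finset Matrix
open Literature.MathematicalPhysics.QuantumFieldTheory.Balaban1983to89.B4ContourShift
open Literature.MathematicalPhysics.QuantumFieldTheory.Balaban1983to89.B4Reflection242
open Literature.MathematicalPhysics.QuantumFieldTheory.Balaban1983to89.B4Green242Bridge
open Literature.MathematicalPhysics.QuantumFieldTheory.Balaban1983to89.B4BoxCov237
open Literature.MathematicalPhysics.QuantumFieldTheory.Balaban1983to89.B4Thm110ZeroBox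
open Literature.MathematicalPhysics.QuantumFieldTheory.Balaban1983to89.B4Thm110ZeroBoxDeriv
open Literature.MathematicalPhysics.QuantumFieldTheory.Balaban1983to89.B4Lemma22ZeroBoxDerivDual (fwd fwd_spec)
open Literature.MathematicalPhysics.QuantumFieldTheory.Balaban1983to89.B4Thm110ZeroBoxMeshOne (thm110_zero_box_roww_coeff_all)
open Literature.MathematicalPhysics.QuantumFieldTheory.Balaban1983to89.B4Thm19ZeroBoxHolderDualMeshOne (lemma22_zero_box_Gdstar_roww_coeff_all)
open Literature.MathematicalPhysics.QuantumFieldTheory.Balaban1983to89.B6Ineq243TwoLevelBox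
open Literature.MathematicalPhysics.QuantumFieldTheory.Balaban1983to89.B6Ineq243AdjTwoLevelBox
open B4Sect5Proof (latticeConst latticeConst_nonneg)

noncomputable section

variable {d : ℕ}

/-! ## §1 (2.43) for `G′(□)∂^{L^{−j}*}_μ` at every mesh `j ≥ 0` -/

/-- LEVEL-0 TWIN: the original with the binder «1 ≤ k» removed (inputs = the all-scales `_all` forms of `B4Thm110ZeroBoxMeshOne` / `B4Thm19ZeroBoxHolderMeshOne` / `B4Thm19ZeroBoxHolderDualMeshOne`; the mesh-free assembly lemmas of the original BY NAME). **[B6] (2.43) FOR THE THIRD OPERATOR `G′(□)∂^{L^{−j}*}_μ` OF [3] LEMMA 2.2, GENUINE TWO-LEVEL CUBE PROPAGATOR,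
AT EVERY MESH `j ≥ 0` (LEVEL-0 TWIN) — weighted form.**  For every dimension `d + 1`, block size `L = ℓ + 1 ≥ 2` and window
(`a_j ∈ [a₋, a₊]`, `m² ∈ [0, m²₊]`, `a ∈ [a₂₋, a₂₊]`, `a₋, a₂₋ > 0`) there are `δ′, c′ > 0` such that for EVERY `j ≥ 0`
(`n = L^j`), every point of the window, EVERY box `□` built of `L`-blocks, EVERY `Λ ⊆ □^{(j)}`, every axis `μ` and
every site `x`: `Σ_{z ∈ □} |ξ^{−1}(G′(□; x, fwd_μ z) − G′(□; x, z))|·e^{δ′|x − z|_∞/L^j} ≤ c′` (`ξ = L^{−j}`; the sum runs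
over the bonds `⟨z, z + ξe_μ⟩ ⊂ □`, sites without a forward bond contributing `0`).  Inputs BY NAME:
`B4Lemma22ZeroBoxDerivDual.lemma22_zero_box_Gdstar_roww_coeff` ([3] Lemma 2.2 (2.17) for `G_k(□)D^{η*}_μ` at `A = 0`),
`B4Thm110ZeroBox.thm110_zero_box_roww_coeff`, `B4BoxCov237.cov116_box_finset_decay` — «From these and (2.42) we get
(2.43)».  HONEST SCOPE: `A = 0`; print displays (2.43) for `G′(□)` and `∂G′(□)` only — this is the same corollary of
(2.42) for the third operator of [3] Lemma 2.2, which (2.67) uses; constants depend on `d`, `ℓ`, the window.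
[cite: Balaban1984PropagatorsII, (2.43) p.230 with Proposition 2.2 (2.67) p.234; Balaban1983RegularityDecay, Lemma 2.2 (2.17) pp.577–578] -/
theorem ineq243_twoLevel_dstar_roww (d ℓ : ℕ) (hℓ : 1 ≤ ℓ) (aminus aplus m2plus a2minus a2plus : ℝ)
    (ha : 0 < aminus) (ha2 : 0 < a2minus) :
    ∃ δ' c' : ℝ, 0 < δ' ∧ 0 < c' ∧ ∀ (k : ℕ) (aj m2 a : ℝ), aminus ≤ aj → aj ≤ aplus → 0 ≤ m2 →
      m2 ≤ m2plus → a2minus ≤ a → a ≤ a2plus → ∀ (M' : Fin (d + 1) → ℕ), (∀ i, 1 ≤ M' i) →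
        ∀ (Λ : Finset ↥(boxDom (fun i => (ℓ + 1) * M' i))) (μ : Fin (d + 1))
          (x : ↥(boxDom (fun i => (ℓ + 1) ^ k * ((ℓ + 1) * M' i)))),
          roww δ' ((ℓ + 1) ^ k) (dstar ((ℓ + 1) ^ k) μ (gTwoLevel ((ℓ + 1) ^ k) ℓ aj a m2 M' Λ)) x ≤ c' := by
  obtain ⟨δ₀, c₀, hδ₀, hc₀, hG⟩ := thm110_zero_box_roww_coeff_all d ℓ hℓ aminus aplus m2plus ha
  obtain ⟨δ₁, c₁, hδ₁, hc₁, hGD⟩ := lemma22_zero_box_Gdstar_roww_coeff_all d ℓ hℓ aminus aplus m2plus ha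
  obtain ⟨δ, c, hδ, hc, hC⟩ := cov116_box_finset_decay d ℓ hℓ aminus aplus m2plus a2minus a2plus ha ha2
  have hδ'pos : 0 < min (min δ₀ δ₁) (δ / 2) := lt_min (lt_min hδ₀ hδ₁) (half_pos hδ)
  have hKn : 0 ≤ latticeConst (d + 1) (δ / 2) := latticeConst_nonneg (d + 1) (half_pos hδ).le
  refine ⟨min (min δ₀ δ₁) (δ / 2),
    c₁ + aplus ^ 2 * (c₀ * (c * Real.exp (min (min δ₀ δ₁) (δ / 2)) * latticeConst (d + 1) (δ / 2)) * c₁),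
    hδ'pos, by positivity, ?_⟩
  intro k aj m2 a h1 h2 h3 h4 h5 h6 M' hM Λ μ x
  have hn1 : 1 ≤ (ℓ + 1) ^ k := Nat.one_le_pow _ _ (by omega)
  have hMℓ : ∀ i, 1 ≤ (ℓ + 1) * M' i := fun i => by nlinarith [hM i]
  have haj : 0 < aj := lt_of_lt_of_le ha h1
  have hGz : ∀ z, roww δ₀ ((ℓ + 1) ^ k) (boxOpR ((ℓ + 1) ^ k) aj m2 (fun i => (ℓ + 1) * M' i))⁻¹ z ≤ c₀ :=
    fun z => hG k aj m2 h1 h2 h3 h4 (fun i => (ℓ + 1) * M' i) hMℓ z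
  have hGDz : ∀ z, roww δ₁ ((ℓ + 1) ^ k)
      (dstar ((ℓ + 1) ^ k) μ (boxOpR ((ℓ + 1) ^ k) aj m2 (fun i => (ℓ + 1) * M' i))⁻¹) z ≤ c₁ := by
    intro z
    rw [roww_dstar]
    exact hGD k aj m2 h1 h2 h3 h4 (fun i => (ℓ + 1) * M' i) hMℓ μ z
  have hCz := (hC ((ℓ + 1) ^ k) hn1 aj m2 a h1 h2 h3 h4 h5 h6 M' hM Λ).2
  have hmain := gTwoLevel_dstar_roww_le hn1 aj a m2 Λ hc₁.le hc.le hδ hδ'pos.le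
    ((min_le_left _ _).trans (min_le_left _ _)) ((min_le_left _ _).trans (min_le_right _ _))
    (min_le_right _ _) hGz hCz μ hGDz x
  refine hmain.trans ?_
  have : aj ^ 2 ≤ aplus ^ 2 := pow_le_pow_left₀ haj.le h2 2
  have h0 : 0 ≤ c₀ * (c * Real.exp (min (min δ₀ δ₁) (δ / 2)) * latticeConst (d + 1) (δ / 2)) * c₁ := by
    positivity
  nlinarith

/-- LEVEL-0 TWIN: the original with the binder «1 ≤ k» removed (inputs = the all-scales `_all` forms of `B4Thm110ZeroBoxMeshOne` / `B4Thm19ZeroBoxHolderMeshOne` / `B4Thm19ZeroBoxHolderDualMeshOne`; the mesh-free assembly lemmas of the original BY NAME). **[B6] (2.43), THIRD OPERATOR — THE PRINTED VALUE CLAUSE** `|(G′(□)∂^{L^{−j}*}_μf)(x)| ≤ O(1)e^{−δ₀dist(x, supp f)}|f|`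
for the genuine two-level cube propagator, at every mesh `j ≥ 0`: for every bond function `f` (`f(z)` = the value on
`⟨z, z + ξe_μ⟩`), every `F ≥ |f|` and every `D ≤ |x − z|_∞` on `supp f` (fine units):
`|Σ_z ξ^{−1}(G′(□; x, fwd_μ z) − G′(□; x, z))f(z)| ≤ c′e^{−δ′D/L^j}F`.
[cite: Balaban1984PropagatorsII, (2.43) p.230 with Proposition 2.2 (2.67) p.234; Balaban1983RegularityDecay, Lemma 2.2 (2.17) pp.577–578] -/
theorem ineq243_twoLevel_dstar_value (d ℓ : ℕ) (hℓ : 1 ≤ ℓ) (aminus aplus m2plus a2minus a2plus : ℝ)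
    (ha : 0 < aminus) (ha2 : 0 < a2minus) :
    ∃ δ' c' : ℝ, 0 < δ' ∧ 0 < c' ∧ ∀ (k : ℕ) (aj m2 a : ℝ), aminus ≤ aj → aj ≤ aplus → 0 ≤ m2 →
      m2 ≤ m2plus → a2minus ≤ a → a ≤ a2plus → ∀ (M' : Fin (d + 1) → ℕ), (∀ i, 1 ≤ M' i) →
        ∀ (Λ : Finset ↥(boxDom (fun i => (ℓ + 1) * M' i))) (μ : Fin (d + 1))
          (f : ↥(boxDom (fun i => (ℓ + 1) ^ k * ((ℓ + 1) * M' i))) → ℝ) (F D : ℝ), (∀ z, |f z| ≤ F) →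
          ∀ x : ↥(boxDom (fun i => (ℓ + 1) ^ k * ((ℓ + 1) * M' i))),
            (∀ z, f z ≠ 0 → D ≤ supNorm (x.1 - z.1)) →
              |(dstar ((ℓ + 1) ^ k) μ (gTwoLevel ((ℓ + 1) ^ k) ℓ aj a m2 M' Λ) *ᵥ f) x|
                ≤ c' * Real.exp (-(δ' * D / (((ℓ + 1) ^ k : ℕ) : ℝ))) * F := by
  obtain ⟨δ', c', hδ', hc', h⟩ := ineq243_twoLevel_dstar_roww d ℓ hℓ aminus aplus m2plus a2minus a2plus ha ha2
  refine ⟨δ', c', hδ', hc', ?_⟩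
  intro k aj m2 a h1 h2 h3 h4 h5 h6 M' hM Λ μ f F D hF x hD
  exact mulVec_le_of_roww hδ'.le _ _ x (h k aj m2 a h1 h2 h3 h4 h5 h6 M' hM Λ μ x) f hF hD

/-! ## §2 Non-vacuity (`d + 1 = 4`, `L = 2`), now for every `k ≥ 0` -/

/-- the main estimate at the physical dimension `d + 1 = 4`, `L = 2`. -/
example : ∃ δ' c' : ℝ, 0 < δ' ∧ 0 < c' ∧ ∀ (k : ℕ) (aj m2 a : ℝ), (1 / 2 : ℝ) ≤ aj → aj ≤ 2 →
    0 ≤ m2 → m2 ≤ 1 → (1 / 2 : ℝ) ≤ a → a ≤ 2 → ∀ (M' : Fin (3 + 1) → ℕ), (∀ i, 1 ≤ M' i) →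
      ∀ (Λ : Finset ↥(boxDom (fun i => (1 + 1) * M' i))) (μ : Fin (3 + 1))
        (x : ↥(boxDom (fun i => (1 + 1) ^ k * ((1 + 1) * M' i)))),
        roww δ' ((1 + 1) ^ k) (dstar ((1 + 1) ^ k) μ (gTwoLevel ((1 + 1) ^ k) 1 aj a m2 M' Λ)) x ≤ c' :=
  ineq243_twoLevel_dstar_roww 3 1 le_rfl (1 / 2) 2 1 (1 / 2) 2 (by norm_num) (by norm_num)


end

end Literature.MathematicalPhysics.QuantumFieldTheory.Balaban1983to89.B6Ineq243AdjTwoLevelBoxL0
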